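import Mathlib
import Literature.Analysis.FluidPDE.TaoCascadeODEProofs
import Literature.Analysis.FluidPDE.Tao2016AveragedNS.SelfSimilarCascadeBlowup
import HarnessLib

/-!
# Table scaling for Tao's cascade and the finite spread of Table 1
  (serves item stmt-NavierStokesRegularity-20421 `TaoLadderRungThree.Target`; MODEL lattice only)

Kernel lemmas used by `TaoLadderRungThreeTargetOfTaoMechanism.lean` (cell harvest/h2-tao-ladder,
p1 g11, 2026-08-27):

* `cascadeFrom_tableScale` — TABLE-SCALING COVARIANCE of the conclusions (4.5)–(4.11) of Tao's
  Lemma 4.1 (`TaoCascade.CascadeODESolutionFrom`): a global family for the table `c · α` (`c > 0`)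
  with defect constants `(K₁, K₂)` is, after the time change `t ↦ c⁻¹ t`, a global family for `α`
  with constants `(K₁ c⁻¹, K₂ c⁻¹)`; hence Theorem 4.2-level blow-up `NoGlobalCascade ε₀ α X₀` is
  invariant under positive scaling of the table (`noGlobalCascade_tableScale`) — the normalisation
  remark of the cell's LADDER §13.1, kernel-checked.
* `isComparableCoeff_scale_of_bounds` — a table whose non-zero structure constants have moduli in
  `[m, M]` is `(M/m)`-comparable (`TaoCascade.IsComparableCoeff`) after division by `M`.
* `taoCoeff_entry_bounds`, `inTableClass_taoCoeff_scaled` — every structure constant of Tao's §6.1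
  Table 1 (`TaoCascade.taoCoeff ε₀ K ε`, `0 ≤ ε₀ ≤ 1`, `0 < ε ≤ 1 ≤ K`) is `0` or has modulus in
  `[ε² e^{-K¹⁰}/2, 8 K¹⁰ ε⁻²]`, so the max-normalised Table 1 lies in the cell's comparable class
  `InTableClass R` with the FINITE spread `R = 16 K¹⁰ e^{K¹⁰} ε⁻⁴ ≥ 1` (`one_le_taoCoeff_spread`).

HONEST FRAMING: elementary statements about Tao's MODEL lattice ODE (Lemma 4.1's conclusions for
a table on Tao's shift set) and about the entries of his Table 1; nothing here is a statement about
the Navier–Stokes equations and nothing here closes any item.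
-/

noncomputable section

set_option linter.dupNamespace false

open Set MeasureTheory

namespace Summit.NavierStokesRegularity.NavierStokesRegularity.Theorems.RungThreeTaoMechanism

open Literature.Analysis.FluidPDE.TaoCascade

/-! ### Table scaling -/

/-- The cascade nonlinearity is linear in the table: `quadTerm (c·α) = c · quadTerm α`.
[cite: Tao2016AveragedNS, §4 (4.8)] -/
theorem quadTerm_tableScale (ε₀ c : ℝ) {m : ℕ} (α : Fin m → Fin m → Fin m → ℤ × ℤ × ℤ → ℝ)
    (X : Fin m → ℤ → ℝ → ℝ) (i : Fin m) (n : ℤ) (t : ℝ) :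
    quadTerm ε₀ (fun a b d μ => c * α a b d μ) X i n t = c * quadTerm ε₀ α X i n t := by
  simp only [quadTerm, Finset.mul_sum]
  refine Finset.sum_congr rfl fun i₁ _ => Finset.sum_congr rfl fun i₂ _ =>
    Finset.sum_congr rfl fun μ _ => ?_
  ring

/-- The cascade nonlinearity commutes with a linear time change of the family (it is pointwise in
time). [cite: Tao2016AveragedNS, §4 (4.8)] -/
theorem quadTerm_timeScale (ε₀ b : ℝ) {m : ℕ} (α : Fin m → Fin m → Fin m → ℤ × ℤ × ℤ → ℝ)
    (X : Fin m → ℤ → ℝ → ℝ) (i : Fin m) (n : ℤ) (t : ℝ) :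
    quadTerm ε₀ α (fun j k s => X j k (b * s)) i n t = quadTerm ε₀ α X i n (b * t) := by
  simp only [quadTerm]

/-- Symmetry (4.2) is preserved by scaling the table. [cite: Tao2016AveragedNS, §4 (4.2)] -/
theorem isSymmetricCoeff_tableScale {m : ℕ} {α : Fin m → Fin m → Fin m → ℤ × ℤ × ℤ → ℝ}
    (h : IsSymmetricCoeff α) (c : ℝ) : IsSymmetricCoeff (fun a b d μ => c * α a b d μ) := by
  intro i₁ i₂ i₃ μ₁ μ₂ μ₃ hμ
  simp only [h i₁ i₂ i₃ μ₁ μ₂ μ₃ hμ]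

/-- Cancellation (4.3) is preserved by scaling the table. [cite: Tao2016AveragedNS, §4 (4.3)] -/
theorem isCancellingCoeff_tableScale {m : ℕ} {α : Fin m → Fin m → Fin m → ℤ × ℤ × ℤ → ℝ}
    (h : IsCancellingCoeff α) (c : ℝ) : IsCancellingCoeff (fun a b d μ => c * α a b d μ) := by
  intro i₁ i₂ i₃ μ₁ μ₂ μ₃ hμ
  have := h i₁ i₂ i₃ μ₁ μ₂ μ₃ hμ
  calc c * α i₁ i₂ i₃ (μ₁, μ₂, μ₃) + c * α i₁ i₃ i₂ (μ₁, μ₃, μ₂) + c * α i₂ i₁ i₃ (μ₂, μ₁, μ₃) +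
        c * α i₂ i₃ i₁ (μ₂, μ₃, μ₁) + c * α i₃ i₁ i₂ (μ₃, μ₁, μ₂) + c * α i₃ i₂ i₁ (μ₃, μ₂, μ₁)
      = c * (α i₁ i₂ i₃ (μ₁, μ₂, μ₃) + α i₁ i₃ i₂ (μ₁, μ₃, μ₂) + α i₂ i₁ i₃ (μ₂, μ₁, μ₃) +
          α i₂ i₃ i₁ (μ₂, μ₃, μ₁) + α i₃ i₁ i₂ (μ₃, μ₁, μ₂) + α i₃ i₂ i₁ (μ₃, μ₂, μ₁)) := by ring
    _ = 0 := by rw [this, mul_zero]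

/-- **A table with non-zero structure constants of modulus in `[m, M]` is `(M/m)`-comparable after
max-normalisation** (division by `M`). [cite: Tao2016AveragedNS, §6.1 (the table being compared); cell vocabulary `IsComparableCoeff`] -/
theorem isComparableCoeff_scale_of_bounds {k : ℕ} {α : Fin k → Fin k → Fin k → ℤ × ℤ × ℤ → ℝ}
    {m M : ℝ} (hm : 0 < m) (hmM : m ≤ M)
    (h : ∀ (i₁ i₂ i₃ : Fin k) (μ : ℤ × ℤ × ℤ), μ ∈ shiftSet →
      α i₁ i₂ i₃ μ = 0 ∨ (m ≤ |α i₁ i₂ i₃ μ| ∧ |α i₁ i₂ i₃ μ| ≤ M)) :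
    IsComparableCoeff (M / m) (fun a b d μ => M⁻¹ * α a b d μ) := by
  have hM : 0 < M := lt_of_lt_of_le hm hmM
  intro i₁ i₂ i₃ μ hμ
  rcases h i₁ i₂ i₃ μ hμ with h0 | ⟨hlo, hhi⟩
  · refine ⟨?_, Or.inl ?_⟩
    · simp only [h0, mul_zero, abs_zero]; exact zero_le_one
    · simp only [h0, mul_zero]
  · have habs : |M⁻¹ * α i₁ i₂ i₃ μ| = M⁻¹ * |α i₁ i₂ i₃ μ| := by
      rw [abs_mul, abs_of_pos (inv_pos.mpr hM)]
    refine ⟨?_, Or.inr ?_⟩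
    · rw [habs]
      calc M⁻¹ * |α i₁ i₂ i₃ μ| ≤ M⁻¹ * M := mul_le_mul_of_nonneg_left hhi (inv_pos.mpr hM).le
        _ = 1 := inv_mul_cancel₀ hM.ne'
    · rw [habs, inv_div]
      calc m / M = M⁻¹ * m := by rw [div_eq_inv_mul]
        _ ≤ M⁻¹ * |α i₁ i₂ i₃ μ| := mul_le_mul_of_nonneg_left hlo (inv_pos.mpr hM).le

/-! ### Table-scaling covariance of the conclusions of Lemma 4.1 -/

/-- **TABLE-SCALING COVARIANCE.** A global family obeying the conclusions (4.5)–(4.11) of Lemma 4.1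
for the scaled table `c · α` (`c > 0`) with defect constants `(K₁, K₂)` yields, by the time change
`t ↦ c⁻¹ t`, one for the table `α` with constants `(K₁ c⁻¹, K₂ c⁻¹)` — the same datum, the same
shells; the nonlinearity is pointwise in time and (4.8)/(4.9)/(4.10) each scale by one factor.
[cite: Tao2016AveragedNS, §4 Lemma 4.1 (4.5)–(4.11)] -/
theorem cascadeFrom_tableScale {ε₀ : ℝ} (hε : 0 < ε₀) {m : ℕ}
    {α : Fin m → Fin m → Fin m → ℤ × ℤ × ℤ → ℝ} {c K₁ K₂ : ℝ} (hc : 0 < c) {n₀ : ℤ}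
    {X₀ : Fin m → ℝ} {X E : Fin m → ℤ → ℝ → ℝ}
    (h : CascadeODESolutionFrom ε₀ (fun a b d μ => c * α a b d μ) K₁ K₂ n₀ X₀ X E) :
    CascadeODESolutionFrom ε₀ α (K₁ * c⁻¹) (K₂ * c⁻¹) n₀ X₀ (fun i n t => X i n (c⁻¹ * t))
      (fun i n t => E i n (c⁻¹ * t)) := by
  have hB : 0 < 1 + ε₀ := by linarith
  have hb : 0 < c⁻¹ := inv_pos.mpr hc
  have hbt : ∀ {t : ℝ}, 0 ≤ t → 0 ≤ c⁻¹ * t := fun ht => mul_nonneg hb.le ht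
  exact
  { contDiffOn_X := fun i n => contDiffOn_comp_mul_Ici (h.contDiffOn_X i n) hb
    contDiffOn_E := fun i n => contDiffOn_comp_mul_Ici (h.contDiffOn_E i n) hb
    nonneg_E := fun i n t ht => h.nonneg_E i n (c⁻¹ * t) (hbt ht)
    apriori_X := by
      intro T hT
      obtain ⟨M, hM⟩ := h.apriori_X (c⁻¹ * T) (mul_pos hb hT)
      exact ⟨M, fun t ht i n => hM (c⁻¹ * t) ⟨hbt ht.1, mul_le_mul_of_nonneg_left ht.2 hb.le⟩ i n⟩
    apriori_E := by
      intro T hT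
      obtain ⟨M, hM⟩ := h.apriori_E (c⁻¹ * T) (mul_pos hb hT)
      exact ⟨M, fun t ht i n => hM (c⁻¹ * t) ⟨hbt ht.1, mul_le_mul_of_nonneg_left ht.2 hb.le⟩ i n⟩
    init_E := fun i n => by simp only [mul_zero]; exact h.init_E i n
    init_X := fun i n => by simp only [mul_zero]; exact h.init_X i n
    motion := by
      intro i n t ht
      have hD : derivWithin (fun s => X i n (c⁻¹ * s)) (Ici 0) t =
          c⁻¹ * derivWithin (X i n) (Ici 0) (c⁻¹ * t) :=
        derivWithin_comp_mul_Ici (h.contDiffOn_X i n) hb ht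
      have hm := h.motion i n (c⁻¹ * t) (hbt ht)
      rw [quadTerm_tableScale] at hm
      rw [hD, quadTerm_timeScale]
      have hq : quadTerm ε₀ α X i n (c⁻¹ * t) = c⁻¹ * (c * quadTerm ε₀ α X i n (c⁻¹ * t)) := by
        rw [← mul_assoc, inv_mul_cancel₀ hc.ne', one_mul]
      rw [hq, ← mul_sub, abs_mul, abs_of_pos hb]
      calc c⁻¹ * |derivWithin (X i n) (Ici 0) (c⁻¹ * t) - c * quadTerm ε₀ α X i n (c⁻¹ * t)|
          ≤ c⁻¹ * (K₁ * (1 + ε₀) ^ ((2 : ℝ) * n) * Real.sqrt (E i n (c⁻¹ * t))) :=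
            mul_le_mul_of_nonneg_left hm hb.le
        _ = K₁ * c⁻¹ * (1 + ε₀) ^ ((2 : ℝ) * n) * Real.sqrt (E i n (c⁻¹ * t)) := by ring
    energy := by
      intro i n t ht
      have hD : derivWithin (fun s => E i n (c⁻¹ * s)) (Ici 0) t =
          c⁻¹ * derivWithin (E i n) (Ici 0) (c⁻¹ * t) :=
        derivWithin_comp_mul_Ici (h.contDiffOn_E i n) hb ht
      have he := h.energy i n (c⁻¹ * t) (hbt ht)
      rw [quadTerm_tableScale] at he
      rw [hD, quadTerm_timeScale]
      calc c⁻¹ * derivWithin (E i n) (Ici 0) (c⁻¹ * t)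
          ≤ c⁻¹ * (c * quadTerm ε₀ α X i n (c⁻¹ * t) * X i n (c⁻¹ * t)) :=
            mul_le_mul_of_nonneg_left he hb.le
        _ = quadTerm ε₀ α X i n (c⁻¹ * t) * X i n (c⁻¹ * t) := by
            rw [← mul_assoc, ← mul_assoc, inv_mul_cancel₀ hc.ne', one_mul]
    defect_lower := fun i n t ht => h.defect_lower i n (c⁻¹ * t) (hbt ht)
    defect_upper := by
      intro i n t ht
      have hint : ∫ s in (0 : ℝ)..c⁻¹ * t, E i n s =
          c⁻¹ * ∫ σ in (0 : ℝ)..t, E i n (c⁻¹ * σ) := by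
        have h1 := intervalIntegral.integral_comp_mul_left (a := 0) (b := t) (E i n) hb.ne'
        rw [mul_zero, smul_eq_mul] at h1
        rw [h1, ← mul_assoc, mul_inv_cancel₀ hb.ne', one_mul]
      have hu := h.defect_upper i n (c⁻¹ * t) (hbt ht)
      rw [hint] at hu
      calc E i n (c⁻¹ * t) ≤ _ := hu
        _ = 1 / 2 * X i n (c⁻¹ * t) ^ 2 +
              K₂ * c⁻¹ * (1 + ε₀) ^ ((2 : ℝ) * n) * ∫ σ in (0 : ℝ)..t, E i n (c⁻¹ * σ) := by ring
    noLow_X := fun i n t hn ht => h.noLow_X i n (c⁻¹ * t) hn (hbt ht)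
    noLow_E := fun i n t hn ht => h.noLow_E i n (c⁻¹ * t) hn (hbt ht) }

/-- **Theorem 4.2-level blow-up is invariant under scaling the table** (`c > 0`): `NoGlobalCascade`
quantifies over all defect constants, and a global family for `c · α` rescales in time to one for
`α`. [cite: Tao2016AveragedNS, §4 Thm. 4.2 (statement shape); cell vocabulary `NoGlobalCascade`] -/
theorem noGlobalCascade_tableScale {ε₀ : ℝ} (hε : 0 < ε₀) {m : ℕ}
    {α : Fin m → Fin m → Fin m → ℤ × ℤ × ℤ → ℝ} {X₀ : Fin m → ℝ} {c : ℝ} (hc : 0 < c)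
    (h : NoGlobalCascade ε₀ α X₀) : NoGlobalCascade ε₀ (fun a b d μ => c * α a b d μ) X₀ := by
  intro K₁ K₂ hK₁ hK₂
  obtain ⟨N₀, hN₀⟩ := h (K₁ * c⁻¹) (K₂ * c⁻¹) (mul_nonneg hK₁ (inv_pos.mpr hc).le)
    (mul_nonneg hK₂ (inv_pos.mpr hc).le)
  exact ⟨N₀, fun n₀ hn₀ ⟨X, E, hXE⟩ => hN₀ n₀ hn₀ ⟨_, _, cascadeFrom_tableScale hε hc hXE⟩⟩

/-! ### Tao's Table 1 at the dyadic scale ratio is comparable with a finite spread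

The nine non-zero moduli of Table 1 at `ε₀ = 1` are `ε`, `ε² e^{-K¹⁰}`, `ε/2`, `ε² e^{-K¹⁰}/2`,
`ε⁻²/2`, `ε⁻¹K¹⁰/2`, `ε⁻¹K¹⁰`, `2^{5/2}K`, `2^{5/2}K/2`; for `0 < ε ≤ 1 ≤ K` each lies in
`[ε² e^{-K¹⁰}/2, 8 K¹⁰ ε⁻²]`. -/

/-- Basic inequalities between the Table-1 parameters for `0 ≤ ε₀ ≤ 1`, `0 < ε ≤ 1 ≤ K`:
`ε² e^{-K¹⁰} ≤ ε² ≤ ε`, `1 ≤ ε⁻¹ ≤ ε⁻²`, `1 ≤ K ≤ K¹⁰`, `1 ≤ (1+ε₀)^{5/2} ≤ 8`. [folklore] -/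
theorem taoCoeff_param_facts {ε₀ K ε : ℝ} (hε₀ : 0 ≤ ε₀) (hε₀1 : ε₀ ≤ 1) (hε : 0 < ε)
    (hε1 : ε ≤ 1) (hK : 1 ≤ K) :
    ε ^ 2 * Real.exp (-K ^ 10) ≤ ε ^ 2 ∧ ε ^ 2 ≤ ε ∧ 1 ≤ ε⁻¹ ∧ ε⁻¹ ≤ (ε ^ 2)⁻¹ ∧ 1 ≤ K ^ 10 ∧
      K ≤ K ^ 10 ∧ (1 : ℝ) ≤ (1 + ε₀) ^ ((5 : ℝ) / 2) ∧ (1 + ε₀) ^ ((5 : ℝ) / 2) ≤ 8 := by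
  have hK0 : 0 < K := lt_of_lt_of_le one_pos hK
  have he1 : Real.exp (-K ^ 10) ≤ 1 := by
    rw [Real.exp_le_one_iff]; have := pow_pos hK0 10; linarith
  have hε2 : 0 < ε ^ 2 := pow_pos hε 2
  refine ⟨by nlinarith, by nlinarith, one_le_inv_iff₀.mpr ⟨hε, hε1⟩,
    (inv_le_inv₀ hε hε2).mpr (by nlinarith), one_le_pow₀ hK, ?_, ?_, ?_⟩
  · calc K = K ^ 1 := (pow_one K).symm
      _ ≤ K ^ 10 := pow_le_pow_right₀ hK (by norm_num)
  · exact Real.one_le_rpow (by linarith) (by norm_num)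
  · calc (1 + ε₀) ^ ((5 : ℝ) / 2) ≤ (1 + ε₀) ^ ((3 : ℕ) : ℝ) :=
          Real.rpow_le_rpow_of_exponent_le (by linarith) (by norm_num)
      _ = (1 + ε₀) ^ 3 := by rw [Real.rpow_natCast]
      _ ≤ 2 ^ 3 := pow_le_pow_left₀ (by linarith) (by linarith) 3
      _ = 8 := by norm_num

/-- A positive value between the two extreme moduli has its absolute value there. [folklore] -/
theorem abs_mem_bounds {lo hi v : ℝ} (hv : 0 ≤ v) (h1 : lo ≤ v) (h2 : v ≤ hi) :
    lo ≤ |v| ∧ |v| ≤ hi := by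
  rw [abs_of_nonneg hv]; exact ⟨h1, h2⟩

/-- The Table-1 moduli `ε`, `ε/2`, `ε² e^{-K¹⁰}`, `ε² e^{-K¹⁰}/2` lie in `[ε² e^{-K¹⁰}/2, 8K¹⁰ε⁻²]`.
[cite: Tao2016AveragedNS, §6.1 Table 1] -/
theorem taoCoeff_small_values_bounds {K ε : ℝ} (hε : 0 < ε) (hε1 : ε ≤ 1) (hK : 1 ≤ K) :
    (ε ^ 2 * Real.exp (-K ^ 10) / 2 ≤ ε ∧ ε ≤ 8 * K ^ 10 / ε ^ 2) ∧
    (ε ^ 2 * Real.exp (-K ^ 10) / 2 ≤ ε / 2 ∧ ε / 2 ≤ 8 * K ^ 10 / ε ^ 2) ∧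
    (ε ^ 2 * Real.exp (-K ^ 10) / 2 ≤ ε ^ 2 * Real.exp (-K ^ 10) ∧
      ε ^ 2 * Real.exp (-K ^ 10) ≤ 8 * K ^ 10 / ε ^ 2) ∧
    (ε ^ 2 * Real.exp (-K ^ 10) / 2 ≤ ε ^ 2 * Real.exp (-K ^ 10) / 2 ∧
      ε ^ 2 * Real.exp (-K ^ 10) / 2 ≤ 8 * K ^ 10 / ε ^ 2) := by
  obtain ⟨h1, h2, -, -, h5, -, -, -⟩ := taoCoeff_param_facts le_rfl zero_le_one hε hε1 hK
  have hε2 : 0 < ε ^ 2 := pow_pos hε 2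
  have he0 : 0 < ε ^ 2 * Real.exp (-K ^ 10) := mul_pos hε2 (Real.exp_pos _)
  have hhi : 1 ≤ 8 * K ^ 10 / ε ^ 2 := by
    rw [le_div_iff₀ hε2]; nlinarith
  refine ⟨⟨by nlinarith, by nlinarith⟩, ⟨by nlinarith, by nlinarith⟩, ⟨by nlinarith, by nlinarith⟩,
    ⟨le_rfl, by nlinarith⟩⟩

/-- The Table-1 moduli `ε⁻²/2`, `ε⁻¹K¹⁰/2`, `ε⁻¹K¹⁰` lie in `[ε² e^{-K¹⁰}/2, 8K¹⁰ε⁻²]`.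
[cite: Tao2016AveragedNS, §6.1 Table 1] -/
theorem taoCoeff_large_values_bounds {K ε : ℝ} (hε : 0 < ε) (hε1 : ε ≤ 1) (hK : 1 ≤ K) :
    (ε ^ 2 * Real.exp (-K ^ 10) / 2 ≤ (ε ^ 2)⁻¹ / 2 ∧ (ε ^ 2)⁻¹ / 2 ≤ 8 * K ^ 10 / ε ^ 2) ∧
    (ε ^ 2 * Real.exp (-K ^ 10) / 2 ≤ ε⁻¹ * K ^ 10 / 2 ∧ ε⁻¹ * K ^ 10 / 2 ≤ 8 * K ^ 10 / ε ^ 2) ∧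
    (ε ^ 2 * Real.exp (-K ^ 10) / 2 ≤ ε⁻¹ * K ^ 10 ∧ ε⁻¹ * K ^ 10 ≤ 8 * K ^ 10 / ε ^ 2) := by
  obtain ⟨h1, h2, h3, h4, h5, -, -, -⟩ := taoCoeff_param_facts le_rfl zero_le_one hε hε1 hK
  have hε2 : 0 < ε ^ 2 := pow_pos hε 2
  have hK10 : 0 < K ^ 10 := by positivity
  have hsmall : ε ^ 2 * Real.exp (-K ^ 10) ≤ 1 := by linarith
  -- `ε⁻¹ K¹⁰ ≤ ε⁻² K¹⁰ ≤ 8 K¹⁰ ε⁻²`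
  have hA : ε⁻¹ * K ^ 10 ≤ 8 * K ^ 10 / ε ^ 2 := by
    rw [le_div_iff₀ hε2]
    have hεε : ε⁻¹ * ε ^ 2 = ε := by
      rw [pow_two, ← mul_assoc, inv_mul_cancel₀ hε.ne', one_mul]
    calc ε⁻¹ * K ^ 10 * ε ^ 2 = (ε⁻¹ * ε ^ 2) * K ^ 10 := by ring
      _ = ε * K ^ 10 := by rw [hεε]
      _ ≤ 1 * K ^ 10 := mul_le_mul_of_nonneg_right hε1 hK10.le
      _ ≤ 8 * K ^ 10 := by linarith
  have hB : 1 ≤ ε⁻¹ * K ^ 10 := by nlinarith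
  have hC : (ε ^ 2)⁻¹ / 2 ≤ 8 * K ^ 10 / ε ^ 2 := by
    rw [div_eq_mul_inv (8 * K ^ 10)]; nlinarith [inv_pos.mpr hε2]
  have hD : 1 ≤ (ε ^ 2)⁻¹ := le_trans h3 h4
  refine ⟨⟨by linarith, hC⟩, ⟨by linarith, by linarith⟩, ⟨by linarith, hA⟩⟩

/-- The scale-coupling moduli `(1+ε₀)^{5/2}K`, `(1+ε₀)^{5/2}K/2` lie in
`[ε² e^{-K¹⁰}/2, 8K¹⁰ε⁻²]` (`0 ≤ ε₀ ≤ 1`). [cite: Tao2016AveragedNS, §6.1 Table 1] -/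
theorem taoCoeff_coupling_values_bounds {ε₀ K ε : ℝ} (hε₀ : 0 ≤ ε₀) (hε₀1 : ε₀ ≤ 1)
    (hε : 0 < ε) (hε1 : ε ≤ 1) (hK : 1 ≤ K) :
    (ε ^ 2 * Real.exp (-K ^ 10) / 2 ≤ (1 + ε₀) ^ ((5 : ℝ) / 2) * K ∧
      (1 + ε₀) ^ ((5 : ℝ) / 2) * K ≤ 8 * K ^ 10 / ε ^ 2) ∧
    (ε ^ 2 * Real.exp (-K ^ 10) / 2 ≤ (1 + ε₀) ^ ((5 : ℝ) / 2) * K / 2 ∧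
      (1 + ε₀) ^ ((5 : ℝ) / 2) * K / 2 ≤ 8 * K ^ 10 / ε ^ 2) := by
  obtain ⟨h1, h2, -, -, h5, h6, h7, h8⟩ := taoCoeff_param_facts hε₀ hε₀1 hε hε1 hK
  have hε2 : 0 < ε ^ 2 := pow_pos hε 2
  have hK0 : 0 < K := lt_of_lt_of_le one_pos hK
  have hsmall : ε ^ 2 * Real.exp (-K ^ 10) ≤ 1 := by linarith
  have hlow : 1 ≤ (1 + ε₀) ^ ((5 : ℝ) / 2) * K := by nlinarith
  have hup : (1 + ε₀) ^ ((5 : ℝ) / 2) * K ≤ 8 * K ^ 10 := by nlinarith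
  have hhi : 8 * K ^ 10 ≤ 8 * K ^ 10 / ε ^ 2 := by
    rw [le_div_iff₀ hε2]; nlinarith [pow_pos hK0 10]
  refine ⟨⟨by linarith, hup.trans hhi⟩, ⟨by linarith, by linarith⟩⟩

/-- The same-scale rows of Table 1 take one of nine values. [cite: Tao2016AveragedNS, §6.1 Table 1] -/
theorem tableZero_values (K ε : ℝ) (a b d : Fin 4) :
    tableZero K ε a b d = 0 ∨ tableZero K ε a b d = ε ∨
      tableZero K ε a b d = ε ^ 2 * Real.exp (-K ^ 10) ∨ tableZero K ε a b d = -ε / 2 ∨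
      tableZero K ε a b d = -(ε ^ 2 * Real.exp (-K ^ 10)) / 2 ∨
      tableZero K ε a b d = (ε ^ 2)⁻¹ / 2 ∨ tableZero K ε a b d = ε⁻¹ * K ^ 10 / 2 ∨
      tableZero K ε a b d = -(ε⁻¹ * K ^ 10) ∨ tableZero K ε a b d = -(ε ^ 2)⁻¹ / 2 := by
  fin_cases a <;> fin_cases b <;> fin_cases d <;> simp [tableZero]

/-- **Every structure constant of Table 1 is `0` or has modulus in `[ε² e^{-K¹⁰}/2, 8 K¹⁰ ε⁻²]`**
(`0 ≤ ε₀ ≤ 1`, `0 < ε ≤ 1 ≤ K`). [cite: Tao2016AveragedNS, §6.1 Table 1] -/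
theorem taoCoeff_entry_bounds {ε₀ K ε : ℝ} (hε₀ : 0 ≤ ε₀) (hε₀1 : ε₀ ≤ 1) (hε : 0 < ε)
    (hε1 : ε ≤ 1) (hK : 1 ≤ K) (a b d : Fin 4) (μ : ℤ × ℤ × ℤ) (hμ : μ ∈ shiftSet) :
    taoCoeff ε₀ K ε a b d μ = 0 ∨
      (ε ^ 2 * Real.exp (-K ^ 10) / 2 ≤ |taoCoeff ε₀ K ε a b d μ| ∧
        |taoCoeff ε₀ K ε a b d μ| ≤ 8 * K ^ 10 / ε ^ 2) := by
  obtain ⟨hs1, hs2, hs3, hs4⟩ := taoCoeff_small_values_bounds hε hε1 hK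
  obtain ⟨hl1, hl2, hl3⟩ := taoCoeff_large_values_bounds hε hε1 hK
  obtain ⟨hc1, hc2⟩ := taoCoeff_coupling_values_bounds hε₀ hε₀1 hε hε1 hK
  have hε2 : 0 < ε ^ 2 := pow_pos hε 2
  have hK0 : 0 < K := lt_of_lt_of_le one_pos hK
  rcases (mem_shiftSet_iff μ).1 hμ with rfl | rfl | rfl | rfl
  · rw [taoCoeff_shift0]
    rcases tableZero_values K ε a b d with h | h | h | h | h | h | h | h | h <;> rw [h]
    · exact Or.inl rfl
    · exact Or.inr (abs_mem_bounds hε.le hs1.1 hs1.2)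
    · exact Or.inr (abs_mem_bounds (by positivity) hs3.1 hs3.2)
    · rw [neg_div, abs_neg]; exact Or.inr (abs_mem_bounds (by positivity) hs2.1 hs2.2)
    · rw [neg_div, abs_neg]; exact Or.inr (abs_mem_bounds (by positivity) hs4.1 hs4.2)
    · exact Or.inr (abs_mem_bounds (by positivity) hl1.1 hl1.2)
    · exact Or.inr (abs_mem_bounds (by positivity) hl2.1 hl2.2)
    · rw [abs_neg]; exact Or.inr (abs_mem_bounds (by positivity) hl3.1 hl3.2)
    · rw [neg_div, abs_neg]; exact Or.inr (abs_mem_bounds (by positivity) hl1.1 hl1.2)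
  · rw [taoCoeff_shift1]
    split_ifs
    · rw [neg_div, abs_neg]; exact Or.inr (abs_mem_bounds (by positivity) hc2.1 hc2.2)
    · exact Or.inl rfl
  · rw [taoCoeff_shift2]
    split_ifs
    · rw [neg_div, abs_neg]; exact Or.inr (abs_mem_bounds (by positivity) hc2.1 hc2.2)
    · exact Or.inl rfl
  · rw [taoCoeff_shift3]
    split_ifs
    · exact Or.inr (abs_mem_bounds (by positivity) hc1.1 hc1.2)
    · exact Or.inl rfl

/-- **The max-normalised Table 1 is in the comparable class** `InTableClass R` with the finite
spread `R = (8 K¹⁰ ε⁻²) / (ε² e^{-K¹⁰}/2) = 16 K¹⁰ e^{K¹⁰} ε⁻⁴` (`0 ≤ ε₀ ≤ 1`, `0 < ε ≤ 1 ≤ K`).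
[cite: Tao2016AveragedNS, §6.1 Table 1, (4.2)–(4.3); cell vocabulary `InTableClass`] -/
theorem inTableClass_taoCoeff_scaled {ε₀ K ε : ℝ} (hε₀ : 0 ≤ ε₀) (hε₀1 : ε₀ ≤ 1) (hε : 0 < ε)
    (hε1 : ε ≤ 1) (hK : 1 ≤ K) :
    InTableClass ((8 * K ^ 10 / ε ^ 2) / (ε ^ 2 * Real.exp (-K ^ 10) / 2))
      (fun a b d μ => (8 * K ^ 10 / ε ^ 2)⁻¹ * taoCoeff ε₀ K ε a b d μ) := by
  refine ⟨isSymmetricCoeff_tableScale (taoCoeff_symmetric ε₀ K ε) _,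
    isCancellingCoeff_tableScale (taoCoeff_cancelling ε₀ K ε) _, ?_⟩
  have hK0 : 0 < K := lt_of_lt_of_le one_pos hK
  have h1 := (taoCoeff_small_values_bounds hε hε1 hK).1
  exact isComparableCoeff_scale_of_bounds (by positivity) (h1.1.trans h1.2)
    (fun i₁ i₂ i₃ μ hμ => taoCoeff_entry_bounds hε₀ hε₀1 hε hε1 hK i₁ i₂ i₃ μ hμ)

/-- The spread `16 K¹⁰ e^{K¹⁰} ε⁻⁴ = (8K¹⁰ε⁻²)/(ε²e^{-K¹⁰}/2)` of the normalised Table 1 is `≥ 1`.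
[cite: Tao2016AveragedNS, §6.1 Table 1] -/
theorem one_le_taoCoeff_spread {K ε : ℝ} (hε : 0 < ε) (hε1 : ε ≤ 1) (hK : 1 ≤ K) :
    (1 : ℝ) ≤ (8 * K ^ 10 / ε ^ 2) / (ε ^ 2 * Real.exp (-K ^ 10) / 2) := by
  have h1 := (taoCoeff_small_values_bounds hε hε1 hK).1
  rw [le_div_iff₀ (by positivity), one_mul]
  exact h1.1.trans h1.2

end Summit.NavierStokesRegularity.NavierStokesRegularity.Theorems.RungThreeTaoMechanism
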